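import Mathlib
import Summits.Ventures.HodgeRepro2.Hypothesis
import Summits.Ventures.HodgeRepro2.BallActionU21
import Summits.Ventures.HodgeRepro2.BallGroup
import Summits.Ventures.HodgeRepro2.BallLines
import Summits.Ventures.HodgeRepro2.BallTransitive
import Summits.Ventures.HodgeRepro2.DefiniteUnitaryBounded
import Summits.Ventures.HodgeRepro2.BallStabilizerBounded
import Summits.Ventures.HodgeRepro2.BallStabilizerCompact

/-!
# The ball as the homogeneous space `U(2,1)/K`

Shimura (J. Math. Soc. Japan 31 (1979), §1, §4) and DR15 §2 identify the ball with the symmetric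
space `G(ℝ)/K_∞` of `U(2,1)`, `K_∞` the compact stabiliser of the origin; the Tier-5 sub-step N1
(`T5BallQuotientDecomposition`, p391785) models `Γ_j\G_∞/K_∞` abstractly and leaves the
identification `Γ_j\G_∞/K_∞ → Γ_j\𝔹²` as prose.  This file packages the `U(2,1)`-half in Mathlib's
vocabulary, on top of p4's transitivity theorem (`BallTransitive.exists_isU21_smul_mulVec_single`,
p389130: every negative line is `g · ℂe₃` for an explicit `g ∈ U(2,1)` — p4's `BallGroup.IsU21` and
`BallLines.hermForm21` are definitionally the `IsInU21` and `hermJ21` of `Hypothesis.lean` /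
`BallActionU21.lean`):

* `exists_isInU21_ballAction_zero_eq` / `exists_isInU21_ballAction_eq` — `U(2,1)` acts transitively
  on `𝔹²` through `ballAction`;
* `u21Action` — the action of the subgroup `u21Subgroup ≤ GL₃(ℂ)` on the ball as a `MulAction`;
  `isPretransitive_u21Action`;
* `ballEquivQuotientStabilizer` — **`𝔹² ≃ U(2,1) ⧸ K`**, `K` the stabiliser of the origin, which is
  the compact `pointStabilizer 0` of `BallStabilizerCompact.lean` (`mem_stabilizer_ballOrigin_iff`).
-/

open Matrix

namespace Summit.Ventures.HodgeRepro2.ShimuraData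

/-- The origin lies in the ball. -/
theorem zero_mem_ball₂ : (0 : Fin 2 → ℂ) ∈ ball₂ := by
  rw [mem_ball₂_iff_hermJ21_homog_neg, hermJ21_homog]
  simp

/-- `homog 0 = e₃`. -/
theorem homog_zero_eq_single : homog (0 : Fin 2 → ℂ) = Pi.single 2 1 := by
  funext i
  fin_cases i <;> simp [homog, Fin.snoc]

/-- **Transitivity at the origin** (from p4's `exists_isU21_smul_mulVec_single`): for every
`z ∈ 𝔹²` there is `g ∈ U(2,1)` with `g · 0 = z`. -/
theorem exists_isInU21_ballAction_zero_eq {z : Fin 2 → ℂ} (hz : z ∈ ball₂) :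
    ∃ g : Matrix (Fin 3) (Fin 3) ℂ, IsInU21 g ∧ ballAction g 0 = z := by
  have hw : BallLines.hermForm21 (homog z) < 0 := (mem_ball₂_iff_hermJ21_homog_neg z).mp hz
  obtain ⟨g, hg, c, hc, hgc⟩ := BallTransitive.exists_isU21_smul_mulVec_single (homog z) hw
  refine ⟨g, hg, ?_⟩
  rw [ballAction_eq_normalizeJ, homog_zero_eq_single]
  change normalizeJ (g *ᵥ BallGroup.e₃) = z
  rw [hgc, normalizeJ_smul hc, normalizeJ_homog]

/-- **`U(2,1)` acts transitively on the ball.** -/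
theorem exists_isInU21_ballAction_eq {z z' : Fin 2 → ℂ} (hz : z ∈ ball₂) (hz' : z' ∈ ball₂) :
    ∃ g : Matrix (Fin 3) (Fin 3) ℂ, IsInU21 g ∧ ballAction g z = z' := by
  obtain ⟨g, hg, hg0⟩ := exists_isInU21_ballAction_zero_eq hz
  obtain ⟨g', hg', hg'0⟩ := exists_isInU21_ballAction_zero_eq hz'
  refine ⟨g' * g⁻¹, hg'.mul hg.inv, ?_⟩
  have hinv : ballAction g⁻¹ z = 0 := by
    rw [← hg0, ← IsInU21.ballAction_mul hg zero_mem_ball₂, Matrix.nonsing_inv_mul _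
      (isUnit_iff_ne_zero.mpr hg.det_ne_zero), ballAction_one]
  rw [IsInU21.ballAction_mul hg.inv hz, hinv, hg'0]

/-! ### The action of the subgroup `U(2,1) ≤ GL₃(ℂ)` on the ball -/

/-- The action of `u21Subgroup` on `𝔹²`. -/
noncomputable instance u21Action : MulAction u21Subgroup ball₂ where
  smul g z := ⟨ballAction ((g : GL (Fin 3) ℂ) : Matrix (Fin 3) (Fin 3) ℂ) z,
    (mem_u21Subgroup.mp g.2).ballAction_mem_ball₂ z.2⟩
  one_smul z := Subtype.ext (by
    show ballAction (((1 : u21Subgroup) : GL (Fin 3) ℂ) : Matrix (Fin 3) (Fin 3) ℂ) z = z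
    rw [Subgroup.coe_one, Units.val_one, ballAction_one])
  mul_smul g g' z := Subtype.ext (by
    show ballAction (((g * g' : u21Subgroup) : GL (Fin 3) ℂ) : Matrix (Fin 3) (Fin 3) ℂ) z =
      ballAction ((g : GL (Fin 3) ℂ) : Matrix (Fin 3) (Fin 3) ℂ)
        (ballAction ((g' : GL (Fin 3) ℂ) : Matrix (Fin 3) (Fin 3) ℂ) z)
    rw [Subgroup.coe_mul, Units.val_mul, IsInU21.ballAction_mul (mem_u21Subgroup.mp g'.2) z.2])

/-- The formula of the action. -/
theorem u21Action_smul_coe (g : u21Subgroup) (z : ball₂) :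
    ((g • z : ball₂) : Fin 2 → ℂ) = ballAction ((g : GL (Fin 3) ℂ) : Matrix (Fin 3) (Fin 3) ℂ) z :=
  rfl

/-- An element of `U(2,1)` as an element of `u21Subgroup`. -/
noncomputable def IsInU21.toUnits {g : Matrix (Fin 3) (Fin 3) ℂ} (hg : IsInU21 g) : u21Subgroup :=
  ⟨Matrix.GeneralLinearGroup.mk'' g (isUnit_iff_ne_zero.mpr hg.det_ne_zero),
    mem_u21Subgroup.mpr hg⟩

/-- The underlying matrix of `IsInU21.toUnits`. -/
theorem IsInU21.coe_toUnits {g : Matrix (Fin 3) (Fin 3) ℂ} (hg : IsInU21 g) :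
    ((hg.toUnits : GL (Fin 3) ℂ) : Matrix (Fin 3) (Fin 3) ℂ) = g :=
  rfl

/-- **`U(2,1)` acts transitively on the ball** (Mathlib's `IsPretransitive`). -/
theorem isPretransitive_u21Action : MulAction.IsPretransitive u21Subgroup ball₂ := by
  refine ⟨fun z z' => ?_⟩
  obtain ⟨g, hg, hgz⟩ := exists_isInU21_ballAction_eq z.2 z'.2
  refine ⟨hg.toUnits, Subtype.ext ?_⟩
  rw [u21Action_smul_coe, hg.coe_toUnits, hgz]

/-- The origin of the ball. -/
noncomputable def ballOrigin : ball₂ := ⟨0, zero_mem_ball₂⟩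

/-- **`𝔹² ≃ U(2,1) ⧸ K`**, `K` the stabiliser of the origin. -/
noncomputable def ballEquivQuotientStabilizer :
    ball₂ ≃ u21Subgroup ⧸ MulAction.stabilizer u21Subgroup ballOrigin :=
  haveI := isPretransitive_u21Action
  ((Equiv.Set.univ ball₂).symm.trans
    (Equiv.setCongr (MulAction.orbit_eq_univ u21Subgroup ballOrigin).symm)).trans
    (MulAction.orbitEquivQuotientStabilizer u21Subgroup ballOrigin)

/-- The stabiliser of the origin is the compact set `pointStabilizer 0` of `BallStabilizerCompact`
(as matrices). -/
theorem mem_stabilizer_ballOrigin_iff (g : u21Subgroup) :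
    g ∈ MulAction.stabilizer u21Subgroup ballOrigin ↔
      ((g : GL (Fin 3) ℂ) : Matrix (Fin 3) (Fin 3) ℂ) ∈ pointStabilizer 0 := by
  rw [MulAction.mem_stabilizer_iff, Subtype.ext_iff, u21Action_smul_coe]
  exact ⟨fun h => ⟨mem_u21Subgroup.mp g.2, h⟩, fun h => h.2⟩

end Summit.Ventures.HodgeRepro2.ShimuraData
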